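import Mathlib
import HarnessLib
import Summits.HubbardSuperconductivity.HubbardSuperconductivity.Theses.ChiralWindow
import Summits.HubbardSuperconductivity.HubbardSuperconductivity.Theorems.ChiralWindowCwChannelInfContinuousTransport
import Summits.HubbardSuperconductivity.HubbardSuperconductivity.Theorems.ChiralWindowCwChannelInfContinuousChemicalPotential
import Literature.MathematicalPhysics.QuantumLattice.KohnLuttingerKernelPolarL2

/-!
# Route `ChiralWindow`, support `CwChannelInfContinuous` (item `stmt-HubbardSuperconductivity-1744`):
continuity of the channel bottom from `L²`-continuity of the polar Kohn–Luttinger kernel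

Assembly of the `μ`-continuity of `μ ↦ channelInf ε μ U χ` on the band interval `(-4, 0)`
(`ε = squareDispersion 1 0`) from

* the two-sided use of the one-sided comparison `channelInf_le_channelInf_add`
  (`…Transport`), fed with
* `Literature…eventually_abs_fermiPolarDOS_sub_le`, `exists_eventually_le_fermiPolarDOS` — the density
  of states `w_μ(θ) = fermiPolarDOS μ θ` is continuous in `μ` uniformly in `θ` and locally uniformly
  bounded below, and
* the two analytic inputs on the polar kernel `M_μ(θ,θ') = w_μ(θ) Γ_μ(γ_μθ, γ_μθ') w_μ(θ')`:
  (K1) `M_μ ∈ L²(dθ dθ' ⌞ (-π,π]²)` for `μ` near `μ₀`, (K2) `∫∫ (M_μ - M_μ₀)² → 0` as `μ → μ₀`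
  (`continuousAt_channelInf_of_kernel`, `continuousOn_channelInf_of_kernel`,
  `cwChannelInfContinuous_of_kernel`), which `Literature…KohnLuttingerKernelPolarL2` derives from the
  torus sublevel estimate (TSL) and the shell-volume estimate (SV) of the square-lattice band;
* the reduction `cwChannelInfContinuous_of_continuousOn` (`…ChemicalPotential`):
  `cwChannelInfContinuous_of_estimates` — **the item `CwChannelInfContinuous` follows from (TSL), (SV)**
  holding uniformly on every compact sub-band `[μ₁, μ₂] ⊂ (-4, 0)`.

No definitions. [folklore]
-/

noncomputable section

open MeasureTheory Real Set Filter Topology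
open scoped ENNReal Classical

-- the tree's namespace `Summit.<Summit>.<Problem>.Theorems` repeats the summit name by design (D-0017)
set_option linter.dupNamespace false

namespace Summit.HubbardSuperconductivity.HubbardSuperconductivity.Theorems

open Literature.MathematicalPhysics.QuantumLattice

/-- The Kohn–Luttinger kernel of the square lattice in polar coordinates, written out (local
notation only, as in `…Transport`). -/
local notation "Mker[" μ ", " U "]" => (fun z : ℝ × ℝ =>
  fermiPolarDOS μ (Prod.fst z) * kohnLuttingerKernel (squareDispersion 1 0) μ U (fermiPolar μ (Prod.fst z))
    (fermiPolar μ (Prod.snd z)) * fermiPolarDOS μ (Prod.snd z))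

/-- The parameter interval `(-π, π]` with Lebesgue measure (local notation only). -/
local notation "λθ" => (volume.restrict (Set.Ioc (-π) π) : Measure ℝ)

/-! ### `L²` triangle inequality in the `√∫f²` spelling -/

/-- `√(∫ F²) ≤ √(∫ G²) + √(∫ (F - G)²)` for real `L²` functions (Minkowski). [folklore] -/
theorem sqrt_integral_sq_le_add {α : Type*} [MeasurableSpace α] {ν : Measure α} {F G : α → ℝ}
    (hF : MemLp F 2 ν) (hG : MemLp G 2 ν) :
    Real.sqrt (∫ z, F z ^ 2 ∂ν) ≤ Real.sqrt (∫ z, G z ^ 2 ∂ν) + Real.sqrt (∫ z, (F z - G z) ^ 2 ∂ν) := by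
  -- `√∫f² = ‖f‖_{L²}` for `MemLp f 2`
  have key : ∀ {f : α → ℝ}, MemLp f 2 ν → Real.sqrt (∫ z, f z ^ 2 ∂ν) = (eLpNorm f 2 ν).toReal := by
    intro f hf
    rw [hf.eLpNorm_eq_integral_rpow_norm (by norm_num) (by norm_num)]
    rw [ENNReal.toReal_ofReal (by positivity)]
    simp only [ENNReal.toReal_ofNat, Real.norm_eq_abs, Real.rpow_two, sq_abs]
    rw [Real.sqrt_eq_rpow]
    norm_num
  rw [show (∫ z, (F z - G z) ^ 2 ∂ν) = ∫ z, (F - G) z ^ 2 ∂ν from rfl, key hF, key hG, key (hF.sub hG)]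
  have htri : eLpNorm F 2 ν ≤ eLpNorm G 2 ν + eLpNorm (F - G) 2 ν := by
    have h := eLpNorm_add_le hG.1 (hF.sub hG).1 (p := 2) (μ := ν) (by norm_num)
    have hfun : G + (F - G) = F := by funext z; simp
    rwa [hfun] at h
  have hfin : eLpNorm G 2 ν + eLpNorm (F - G) 2 ν ≠ ⊤ :=
    ENNReal.add_ne_top.2 ⟨hG.eLpNorm_ne_top, (hF.sub hG).eLpNorm_ne_top⟩
  have := ENNReal.toReal_mono hfin htri
  rwa [ENNReal.toReal_add hG.eLpNorm_ne_top (hF.sub hG).eLpNorm_ne_top] at this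

/-! ### Continuity of the channel bottom from the kernel inputs (K1), (K2) -/

/-- **Continuity at `μ₀` of `μ ↦ channelInf ε μ U χ` from `L²`-continuity of the polar kernel.**
Hypotheses: (K1) `M_μ ∈ L²` eventually in `μ → μ₀`; (K2) `∫∫ (M_μ - M_μ₀)² → 0`. Proof: the
one-sided comparison `channelInf_le_channelInf_add` in both directions, with `w₀` a local uniform
lower bound of the density of states and `η = sup_θ |w_μ - w_μ₀| → 0`. [folklore] -/
theorem continuousAt_channelInf_of_kernel (U : ℝ) (χ : D4Irrep) {μ₀ : ℝ} (hμ₀ : μ₀ ∈ Ioo (-4 : ℝ) 0)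
    (hK1 : ∀ᶠ μ in 𝓝 μ₀, MemLp Mker[μ, U] 2 ((λθ).prod λθ))
    (hK2 : Tendsto (fun μ => ∫ z, (Mker[μ, U] z - Mker[μ₀, U] z) ^ 2 ∂((λθ).prod λθ)) (𝓝 μ₀) (𝓝 0)) :
    ContinuousAt (fun μ => channelInf (squareDispersion 1 0) μ U χ) μ₀ := by
  have hM₀ : MemLp Mker[μ₀, U] 2 ((λθ).prod λθ) := hK1.self_of_nhds
  obtain ⟨w₀, hw₀, hwμ₀, hwev⟩ := exists_eventually_le_fermiPolarDOS hμ₀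
  set A₀ := Real.sqrt (∫ z, Mker[μ₀, U] z ^ 2 ∂((λθ).prod λθ)) with hA₀
  have hA₀0 : 0 ≤ A₀ := Real.sqrt_nonneg _
  rw [Metric.continuousAt_iff]
  intro e he
  -- the size of `η`
  set η : ℝ := min (w₀ / 2) (e * w₀ ^ 2 / (16 * (A₀ + 1))) with hη
  have hη0 : 0 < η := by rw [hη]; positivity
  have hηw : 2 * η ≤ w₀ := by have := min_le_left (w₀ / 2) (e * w₀ ^ 2 / (16 * (A₀ + 1))); linarith
  have hηA : 2 * ((A₀ + 1) / w₀) * (η / w₀) ≤ e / 8 := by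
    have h1 : η ≤ e * w₀ ^ 2 / (16 * (A₀ + 1)) := min_le_right _ _
    rw [show 2 * ((A₀ + 1) / w₀) * (η / w₀) = 2 * (A₀ + 1) * η / w₀ ^ 2 by field_simp]
    rw [div_le_iff₀ (by positivity)]
    have h2 := mul_le_mul_of_nonneg_left h1 (show (0 : ℝ) ≤ 2 * (A₀ + 1) by positivity)
    calc 2 * (A₀ + 1) * η ≤ 2 * (A₀ + 1) * (e * w₀ ^ 2 / (16 * (A₀ + 1))) := h2
      _ = e / 8 * w₀ ^ 2 := by field_simp; ring
  -- the size of `D = ‖M_μ - M_μ₀‖₂`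
  have hD : ∀ᶠ μ in 𝓝 μ₀, Real.sqrt (∫ z, (Mker[μ, U] z - Mker[μ₀, U] z) ^ 2 ∂((λθ).prod λθ)) <
      min 1 (e * w₀ / 16) := by
    have ht := hK2.sqrt
    rw [Real.sqrt_zero] at ht
    exact ht (Iio_mem_nhds (by positivity))
  have hball := (((hK1.and hD).and (eventually_abs_fermiPolarDOS_sub_le hμ₀ hη0)).and hwev).and
    (isOpen_Ioo.mem_nhds hμ₀)
  obtain ⟨δ, hδ, hδball⟩ := Metric.eventually_nhds_iff.1 hball
  refine ⟨δ, hδ, fun μ hμ => ?_⟩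
  obtain ⟨⟨⟨⟨hMμ, hDμ⟩, hημ⟩, hwμ⟩, hμI⟩ := hδball hμ
  set D := Real.sqrt (∫ z, (Mker[μ, U] z - Mker[μ₀, U] z) ^ 2 ∂((λθ).prod λθ)) with hDdef
  have hD0 : 0 ≤ D := Real.sqrt_nonneg _
  have hD1 : D < 1 := hDμ.trans_le (min_le_left _ _)
  have hDe : D < e * w₀ / 16 := hDμ.trans_le (min_le_right _ _)
  have hDe' : 2 * D / w₀ ≤ e / 8 := by
    rw [div_le_iff₀ hw₀]; linarith
  -- direction (i): `Λ_μ ≤ Λ_μ₀ + …`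
  have h1 := channelInf_le_channelInf_add hμ₀.1 hμ₀.2 hμI.1 hμI.2 U χ hw₀ hwμ₀ hη0.le hημ hηw hM₀ hMμ
  -- direction (ii): `Λ_μ₀ ≤ Λ_μ + …` (roles swapped; the kernel norm at `μ` is at most `A₀ + D`)
  have hημ' : ∀ θ, |fermiPolarDOS μ₀ θ - fermiPolarDOS μ θ| ≤ η := fun θ => by rw [abs_sub_comm]; exact hημ θ
  have h2 := channelInf_le_channelInf_add hμI.1 hμI.2 hμ₀.1 hμ₀.2 U χ hw₀ hwμ hη0.le hημ' hηw hMμ hM₀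
  have hsymm : Real.sqrt (∫ z, (Mker[μ₀, U] z - Mker[μ, U] z) ^ 2 ∂((λθ).prod λθ)) = D := by
    rw [hDdef]; congr 1
    refine integral_congr_ae (Eventually.of_forall fun z => ?_)
    ring
  have hAμ : Real.sqrt (∫ z, Mker[μ, U] z ^ 2 ∂((λθ).prod λθ)) ≤ A₀ + D := sqrt_integral_sq_le_add hMμ hM₀
  rw [hsymm] at h2
  -- arithmetic
  have hi : channelInf (squareDispersion 1 0) μ U χ - channelInf (squareDispersion 1 0) μ₀ U χ ≤ e / 4 := by
    have hA' : 2 * (A₀ / w₀) * (η / w₀) ≤ e / 8 := by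
      refine le_trans ?_ hηA
      gcongr
      linarith
    linarith
  have hii : channelInf (squareDispersion 1 0) μ₀ U χ - channelInf (squareDispersion 1 0) μ U χ ≤ e / 4 := by
    have hA' : 2 * (Real.sqrt (∫ z, Mker[μ, U] z ^ 2 ∂((λθ).prod λθ)) / w₀) * (η / w₀) ≤ e / 8 := by
      refine le_trans ?_ hηA
      gcongr
      linarith
    linarith
  rw [Real.dist_eq, abs_lt]
  constructor <;> linarith

/-- **`ContinuousOn (μ ↦ channelInf ε μ U χ) (Ioo (-4) 0)` from the kernel inputs (K1), (K2) at every
level of the band.** [folklore] -/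
theorem continuousOn_channelInf_of_kernel (U : ℝ) (χ : D4Irrep)
    (hK1 : ∀ μ ∈ Ioo (-4 : ℝ) 0, MemLp Mker[μ, U] 2 ((λθ).prod λθ))
    (hK2 : ∀ μ₀ ∈ Ioo (-4 : ℝ) 0,
      Tendsto (fun μ => ∫ z, (Mker[μ, U] z - Mker[μ₀, U] z) ^ 2 ∂((λθ).prod λθ)) (𝓝 μ₀) (𝓝 0)) :
    ContinuousOn (fun μ => channelInf (squareDispersion 1 0) μ U χ) (Ioo (-4 : ℝ) 0) := by
  intro μ₀ hμ₀
  refine (continuousAt_channelInf_of_kernel U χ hμ₀ ?_ (hK2 μ₀ hμ₀)).continuousWithinAt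
  filter_upwards [isOpen_Ioo.mem_nhds hμ₀] with μ hμ
  exact hK1 μ hμ

/-- **The item from the kernel inputs**: if for every coupling `U` the polar Kohn–Luttinger kernel
`M_μ` of the square lattice satisfies (K1) `M_μ ∈ L²(dθdθ')` on the band `(-4,0)` and (K2)
`L²`-continuity in `μ`, then `CwChannelInfContinuous` holds (via `cwChannelInfContinuous_of_continuousOn`).
[folklore] -/
theorem cwChannelInfContinuous_of_kernel
    (hK1 : ∀ (U : ℝ), ∀ μ ∈ Ioo (-4 : ℝ) 0, MemLp Mker[μ, U] 2 ((λθ).prod λθ))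
    (hK2 : ∀ (U : ℝ), ∀ μ₀ ∈ Ioo (-4 : ℝ) 0,
      Tendsto (fun μ => ∫ z, (Mker[μ, U] z - Mker[μ₀, U] z) ^ 2 ∂((λθ).prod λθ)) (𝓝 μ₀) (𝓝 0)) :
    Summit.HubbardSuperconductivity.HubbardSuperconductivity.Theses.ChiralWindow.CwChannelInfContinuous :=
  cwChannelInfContinuous_of_continuousOn fun U χ => continuousOn_channelInf_of_kernel U χ (hK1 U) (hK2 U)

/-- **The item from the two geometric estimates on the square-lattice band**: if on every compact
sub-band `[μ₁, μ₂] ⊂ (-4, 0)` the torus sublevel estimate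
(TSL) `|{(θ,θ') ∈ (-π,π]² : |ε(p + γ_μθ + γ_μθ') - μ| < s}| ≤ C s^β` (some `C ≥ 0`, `0 < β < 2`,
uniformly in `p` and `μ`) and the shell-volume estimate (SV) `|BZ ∩ {|ε - μ| < t}| ≤ C_sh t` hold
uniformly in `μ`, then `CwChannelInfContinuous` holds: (TSL)+(SV) give (K1), (K2)
(`Literature…memLp_klKernelPolar`, `tendsto_integral_sq_klKernelPolar_sub`) at every `μ₀ ∈ (-4,0)`
(applied on `[(μ₀-4)/2, μ₀/2] ∋ μ₀`), and `cwChannelInfContinuous_of_kernel` concludes. [folklore] -/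
theorem cwChannelInfContinuous_of_estimates
    (hTSL : ∀ μ₁ μ₂ : ℝ, -4 < μ₁ → μ₂ < 0 → ∃ C β : ℝ, 0 ≤ C ∧ 0 < β ∧ β < 2 ∧
      ∀ μ ∈ Icc μ₁ μ₂, ∀ (p : Momentum) (s : ℝ), 0 < s →
        ((λθ).prod λθ) {z : ℝ × ℝ | |squareDispersion 1 0 (p + (fermiPolar μ z.1 + fermiPolar μ z.2)) - μ| < s} ≤
          ENNReal.ofReal (C * s ^ β))
    (hSV : ∀ μ₁ μ₂ : ℝ, -4 < μ₁ → μ₂ < 0 → ∃ Csh : ℝ, 0 ≤ Csh ∧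
      ∀ μ ∈ Icc μ₁ μ₂, ∀ t : ℝ, 0 < t →
        volume (brillouinZone ∩ {p : Momentum | |squareDispersion 1 0 p - μ| < t}) ≤ ENNReal.ofReal (Csh * t)) :
    Summit.HubbardSuperconductivity.HubbardSuperconductivity.Theses.ChiralWindow.CwChannelInfContinuous := by
  refine cwChannelInfContinuous_of_kernel (fun U μ hμ => ?_) (fun U μ₀ hμ₀ => ?_)
  · -- (K1) at `μ`: the degenerate sub-band `[μ, μ]`
    obtain ⟨C, β, hC, hβ0, hβ2, hT⟩ := hTSL μ μ hμ.1 hμ.2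
    obtain ⟨Csh, hCsh, hS⟩ := hSV μ μ hμ.1 hμ.2
    exact memLp_klKernelPolar hμ.1 hμ.2 U hC hβ0 hβ2 hCsh (hT μ ⟨le_rfl, le_rfl⟩) (hS μ ⟨le_rfl, le_rfl⟩)
  · -- (K2) at `μ₀`: the sub-band `[(μ₀ - 4)/2, μ₀/2] ∋ μ₀`
    have h1 : -4 < (μ₀ - 4) / 2 := by linarith [hμ₀.1]
    have h2 : μ₀ / 2 < 0 := by linarith [hμ₀.2]
    obtain ⟨C, β, hC, hβ0, hβ2, hT⟩ := hTSL _ _ h1 h2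
    obtain ⟨Csh, hCsh, hS⟩ := hSV _ _ h1 h2
    exact tendsto_integral_sq_klKernelPolar_sub h1 h2 U hC hβ0 hβ2 hCsh hT hS
      ⟨by linarith [hμ₀.1], by linarith [hμ₀.2]⟩

end Summit.HubbardSuperconductivity.HubbardSuperconductivity.Theorems

end
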